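import Literature.Analysis.FluidPDE.ClassicalSolution
import Literature.Analysis.FluidPDE.VectorCalculus
import Literature.Analysis.FluidPDE.WholeSpaceIBP
import Mathlib

/-!
# Linear-flow witness, I: clocks and the exact linear Navier–Stokes flow

Negative-side support for crux `AdaptedFrequencyConverges` (stmt-NavierStokesRegularity-10493, route
`AdaptedFrequency`), cdisprove seat, cycle 1 (2026-08-16). Part of the kernel-checked proof that the crux is FALSE once
its far-field hypotheses (Leray–Hopf class, rapid decay, sup-norm Type-I) are dropped — `AdaptedFrequencyConvergesWithoutDecay`
in `…Negative.FalseWithoutDecay` — by an EXACT linear Navier–Stokes flow with an EXACT anisotropic Gaussian adapted kernel whose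
adapted frequency `Λ(t) = 2 cos log(1−t)` does not converge.

This file: the clocks `ω(t) = exp(−sin log(1−t))` (vorticity amplitude) and `d = ω′/ω = cos log(1−t)/(1−t)` (strain
rate), and the linear flow `u = d D₀x + ½ω e₀×x`, `D₀ = diag(1,−½,−½)`, with quadratic pressure: an exact classical
solution of UNFORCED Navier–Stokes on `[0,1) × ℝ³` for every viscosity (`isClassicalNSSolutionOn_vel`), with spatially
constant vorticity `ω(t) e₀`, divergence free, `Δu = 0`.
-/

noncomputable section

namespace Summit.NavierStokesRegularity.NavierStokesRegularity.Theorems.AdaptedFrequencyConverges.Negative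

open scoped Matrix InnerProductSpace RealInnerProductSpace Laplacian Topology
open Literature.Analysis.FluidPDE Set Filter MeasureTheory Real intervalIntegral

/-- physical space [folklore] -/
abbrev E3 := EuclideanSpace ℝ (Fin 3)

/-! ## Part A: clocks and variances -/

/-- The vorticity amplitude clock `ω(t) = exp(−sin log(1−t))`: bounded between `e⁻¹` and `e`, smooth on `t < 1`, oscillating infinitely often as `t ↑ 1`. [folklore] -/
def amp (t : ℝ) : ℝ := Real.exp (-Real.sin (Real.log (1 - t)))
/-- The strain rate `d(t) = cos log(1−t) / (1−t) = ω′/ω`: critical (`∼ (1−t)⁻¹`) and sign-changing. [folklore] -/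
def str (t : ℝ) : ℝ := Real.cos (Real.log (1 - t)) / (1 - t)

/-- `ω(t) > 0`. [folklore] -/
theorem amp_pos (t : ℝ) : 0 < amp t := Real.exp_pos _
/-- `ω(t) ≤ e`. [folklore] -/
theorem amp_le (t : ℝ) : amp t ≤ Real.exp 1 := by
  unfold amp; gcongr; linarith [Real.neg_one_le_sin (Real.log (1 - t)), Real.sin_le_one (Real.log (1 - t))]
/-- `e⁻¹ ≤ ω(t)`. [folklore] -/
theorem le_amp (t : ℝ) : Real.exp (-1) ≤ amp t := by
  unfold amp; gcongr; linarith [Real.sin_le_one (Real.log (1 - t))]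

/-- Derivative of `s ↦ 1 − s`. [folklore] -/
theorem hasDerivAt_one_sub (t : ℝ) : HasDerivAt (fun s : ℝ => 1 - s) (-1) t :=
  (hasDerivAt_id t).const_sub 1

/-- Derivative of `s ↦ log(1 − s)` below `1`. [folklore] -/
theorem hasDerivAt_log_one_sub {t : ℝ} (ht : t < 1) :
    HasDerivAt (fun s => Real.log (1 - s)) (-(1 - t)⁻¹) t := by
  have h2 := (Real.hasDerivAt_log (sub_pos.2 ht).ne').comp t (hasDerivAt_one_sub t)
  exact h2.congr_deriv (by ring)

/-- **The stretching law** `ω′ = d ω` (by design of the clocks). [folklore] -/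
theorem hasDerivAt_amp {t : ℝ} (ht : t < 1) : HasDerivAt amp (amp t * str t) t := by
  have h := ((hasDerivAt_log_one_sub ht).sin.neg).exp
  refine h.congr_deriv ?_
  simp only [Pi.neg_apply, amp, str, div_eq_mul_inv]
  ring

/-- `ω` is smooth below `t = 1`. [folklore] -/
theorem contDiffAt_amp {t : ℝ} (ht : t < 1) {n : WithTop ℕ∞} : ContDiffAt ℝ n amp t := by
  have h1 : ContDiffAt ℝ n (fun s : ℝ => 1 - s) t := contDiffAt_const.sub contDiffAt_id
  exact ((h1.log (sub_pos.2 ht).ne').sin.neg).exp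

/-- `ω` is continuous below `t = 1`. [folklore] -/
theorem continuousAt_amp {t : ℝ} (ht : t < 1) : ContinuousAt amp t :=
  (contDiffAt_amp ht (n := 0)).continuousAt

/-- `ω` is continuous on `(−∞, 1)`. [folklore] -/
theorem continuousOn_amp : ContinuousOn amp (Iio 1) := fun _ ht =>
  (continuousAt_amp ht).continuousWithinAt

/-- `ω` is measurable. [folklore] -/
theorem measurable_amp : Measurable amp := by
  unfold amp; fun_prop

/-! ## Part B: the linear flow -/

/-- `d′(t)` [folklore] -/
def strDeriv (t : ℝ) : ℝ :=
  (Real.sin (Real.log (1 - t)) + Real.cos (Real.log (1 - t))) / (1 - t) ^ 2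

/-- `d′ = strDeriv`. [folklore] -/
theorem hasDerivAt_str {t : ℝ} (ht : t < 1) : HasDerivAt str (strDeriv t) t := by
  have h := ((hasDerivAt_log_one_sub ht).cos).div (hasDerivAt_one_sub t) (sub_pos.2 ht).ne'
  have h1t : (1 - t) ≠ 0 := (sub_pos.2 ht).ne'
  refine h.congr_deriv ?_
  simp only [strDeriv]
  field_simp
  ring

/-- `d` is smooth below `1`. [folklore] -/
theorem contDiffAt_str {t : ℝ} (ht : t < 1) {n : WithTop ℕ∞} : ContDiffAt ℝ n str t := by
  have h1 : ContDiffAt ℝ n (fun s : ℝ => 1 - s) t := contDiffAt_const.sub contDiffAt_id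
  exact ((h1.log (sub_pos.2 ht).ne').cos).div h1 (sub_pos.2 ht).ne'

/-- `d′` is smooth below `1`. [folklore] -/
theorem contDiffAt_strDeriv {t : ℝ} (ht : t < 1) {n : WithTop ℕ∞} : ContDiffAt ℝ n strDeriv t := by
  have h1 : ContDiffAt ℝ n (fun s : ℝ => 1 - s) t := contDiffAt_const.sub contDiffAt_id
  have hl := h1.log (sub_pos.2 ht).ne'
  exact (hl.sin.add hl.cos).div (h1.pow 2) (pow_ne_zero 2 (sub_pos.2 ht).ne')

/-! ### linear algebra -/

/-- The traceless axisymmetric strain matrix `diag(1, −½, −½)`. [folklore] -/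
def D0M : Matrix (Fin 3) (Fin 3) ℝ := !![1, 0, 0; 0, -1/2, 0; 0, 0, -1/2]
/-- The rotation generator about `e₀`: `J x = e₀ × x = (0, −x₂, x₁)`. [folklore] -/
def JM : Matrix (Fin 3) (Fin 3) ℝ := !![0, 0, 0; 0, 0, -1; 0, 1, 0]

/-- `D₀` as a continuous linear map of `ℝ³`. [folklore] -/
def D0 : E3 →L[ℝ] E3 := Matrix.toEuclideanCLM (𝕜 := ℝ) D0M
/-- `J` as a continuous linear map of `ℝ³`. [folklore] -/
def J : E3 →L[ℝ] E3 := Matrix.toEuclideanCLM (𝕜 := ℝ) JM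

/-- `(D₀x)₀ = x₀`. [folklore] -/
@[simp] theorem D0_apply0 (x : E3) : (D0 x) 0 = x 0 := by
  simp [D0, D0M, Matrix.mulVec, dotProduct, Fin.sum_univ_three]
/-- `(D₀x)₁ = −x₁/2`. [folklore] -/
@[simp] theorem D0_apply1 (x : E3) : (D0 x) 1 = -(x 1) / 2 := by
  simp [D0, D0M, Matrix.mulVec, dotProduct, Fin.sum_univ_three]; ring
/-- `(D₀x)₂ = −x₂/2`. [folklore] -/
@[simp] theorem D0_apply2 (x : E3) : (D0 x) 2 = -(x 2) / 2 := by
  simp [D0, D0M, Matrix.mulVec, dotProduct, Fin.sum_univ_three]; ring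
/-- `(Jx)₀ = 0`. [folklore] -/
@[simp] theorem J_apply0 (x : E3) : (J x) 0 = 0 := by
  simp [J, JM, Matrix.mulVec, dotProduct, Fin.sum_univ_three]
/-- `(Jx)₁ = −x₂`. [folklore] -/
@[simp] theorem J_apply1 (x : E3) : (J x) 1 = -(x 2) := by
  simp [J, JM, Matrix.mulVec, dotProduct, Fin.sum_univ_three]
/-- `(Jx)₂ = x₁`. [folklore] -/
@[simp] theorem J_apply2 (x : E3) : (J x) 2 = x 1 := by
  simp [J, JM, Matrix.mulVec, dotProduct, Fin.sum_univ_three]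

/-- the linear velocity field with strain rate `a` and rotation rate `b/2`. [folklore] -/
def linVel (a b : ℝ) (x : E3) : E3 := a • D0 x + (b / 2) • J x

/-- The linear field is the continuous linear map `a D₀ + (b/2) J`. [folklore] -/
theorem linVel_eq (a b : ℝ) : linVel a b = ⇑(a • D0 + (b / 2) • J) := by
  funext x; simp [linVel]

/-- Its Fréchet derivative is itself. [folklore] -/
theorem hasFDerivAt_linVel (a b : ℝ) (x : E3) :
    HasFDerivAt (linVel a b) (a • D0 + (b / 2) • J) x := by
  rw [linVel_eq]; exact (a • D0 + (b / 2) • J).hasFDerivAt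

/-- `D(linVel a b) = a D₀ + (b/2) J`. [folklore] -/
theorem fderiv_linVel (a b : ℝ) (x : E3) : fderiv ℝ (linVel a b) x = a • D0 + (b / 2) • J :=
  (hasFDerivAt_linVel a b x).fderiv

/-- The linear field is smooth. [folklore] -/
theorem contDiff_linVel (a b : ℝ) {n : WithTop ℕ∞} : ContDiff ℝ n (linVel a b) := by
  rw [linVel_eq]; exact (a • D0 + (b / 2) • J).contDiff

/-- Coordinate `0` of the linear field. [folklore] -/
@[simp] theorem linVel_apply0 (a b : ℝ) (x : E3) : (linVel a b x) 0 = a * x 0 := by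
  simp [linVel]
/-- Coordinate `1` of the linear field. [folklore] -/
@[simp] theorem linVel_apply1 (a b : ℝ) (x : E3) :
    (linVel a b x) 1 = -(a / 2) * x 1 - (b / 2) * x 2 := by
  simp [linVel]; ring
/-- Coordinate `2` of the linear field. [folklore] -/
@[simp] theorem linVel_apply2 (a b : ℝ) (x : E3) :
    (linVel a b x) 2 = -(a / 2) * x 2 + (b / 2) * x 1 := by
  simp [linVel]; ring

/-- **The vorticity of the linear field is spatially constant**: `curl (a D₀x + (b/2) e₀×x) = b e₀`. [folklore] -/
theorem curl_linVel (a b : ℝ) (x : E3) : curl (linVel a b) x = EuclideanSpace.single 0 b := by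
  simp only [curl, fderiv_linVel]
  ext i
  fin_cases i <;> simp

/-- `‖curl‖² = b²`. [folklore] -/
theorem norm_curl_linVel_sq (a b : ℝ) (x : E3) : ‖curl (linVel a b) x‖ ^ 2 = b ^ 2 := by
  rw [curl_linVel, EuclideanSpace.norm_eq, Real.sq_sqrt (by positivity)]
  simp

/-- The linear field is divergence free (`tr D₀ = tr J = 0`). [folklore] -/
theorem divergence_linVel (a b : ℝ) (x : E3) : VectorCalculus.divergence (linVel a b) x = 0 := by
  rw [divergence_eq_sum_inner_fderiv (EuclideanSpace.basisFun (Fin 3) ℝ), fderiv_linVel]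
  simp [Fin.sum_univ_three, EuclideanSpace.inner_single_left]
  ring

/-- The (vector) Laplacian of a linear field vanishes. [folklore] -/
theorem laplacian_linVel (a b : ℝ) (x : E3) : (Δ (linVel a b)) x = 0 := by
  rw [laplacian_eq_sum_fderiv_fderiv (EuclideanSpace.basisFun (Fin 3) ℝ) (contDiff_linVel a b)]
  simp [fderiv_linVel]

/-- `(u·∇)u = (a D₀ + (b/2) J) u` for the linear field. [folklore] -/
theorem convect_linVel (a b : ℝ) (x : E3) :
    convect (linVel a b) (linVel a b) x = (a • D0 + (b / 2) • J) (linVel a b x) := by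
  rw [convect_apply, fderiv_linVel]

/-! ### the exact solution -/

/-- **The witness velocity** `u(t, x) = d(t) D₀x + ½ω(t) e₀×x` (exact linear Navier–Stokes flow, any viscosity). [folklore] -/
def vel (t : ℝ) (x : E3) : E3 := linVel (str t) (amp t) x

/-- Axial pressure coefficient `P₁ = d′ + d²`. [folklore] -/
def P1 (t : ℝ) : ℝ := strDeriv t + str t ^ 2
/-- Transverse pressure coefficient `P₂ = −d′/2 + d²/4 − ω²/4`. [folklore] -/
def P2 (t : ℝ) : ℝ := -(strDeriv t) / 2 + (str t) ^ 2 / 4 - (amp t) ^ 2 / 4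

/-- **The witness pressure** `p(t, x) = −½(P₁ x₀² + P₂ (x₁² + x₂²))`. [folklore] -/
def pres (t : ℝ) (x : E3) : ℝ := -(1/2) * (P1 t * (x 0) ^ 2 + P2 t * ((x 1) ^ 2 + (x 2) ^ 2))

/-- gradient vector of the pressure [folklore] -/
def presGrad (t : ℝ) (x : E3) : E3 := !₂[-(P1 t * x 0), -(P2 t * x 1), -(P2 t * x 2)]

/-- coordinate functionals [folklore] -/
def crd (i : Fin 3) : E3 →L[ℝ] ℝ := PiLp.proj 2 (fun _ : Fin 3 => ℝ) i

/-- `crd i x = xᵢ`. [folklore] -/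
@[simp] theorem crd_apply (i : Fin 3) (x : E3) : crd i x = x i := rfl

/-- The pressure gradient is `−(P₁x₀, P₂x₁, P₂x₂)`. [folklore] -/
theorem hasGradientAt_pres (t : ℝ) (x : E3) : HasGradientAt (pres t) (presGrad t x) x := by
  rw [hasGradientAt_iff_hasFDerivAt]
  have h0 := ((crd 0).hasFDerivAt (x := x)).pow 2
  have h1 := ((crd 1).hasFDerivAt (x := x)).pow 2
  have h2 := ((crd 2).hasFDerivAt (x := x)).pow 2
  have h := ((h0.const_mul (P1 t)).add ((h1.add h2).const_mul (P2 t))).const_mul (-(1/2) : ℝ)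
  have h' : HasFDerivAt (pres t) _ x :=
    h.congr_of_eventuallyEq (Eventually.of_forall fun y => by simp [pres])
  refine h'.congr_fderiv ?_
  ext v
  simp [presGrad, PiLp.inner_apply, Fin.sum_univ_three]
  ring

/-- `∇p = presGrad`. [folklore] -/
theorem gradient_pres (t : ℝ) (x : E3) : gradient (pres t) x = presGrad t x :=
  (hasGradientAt_pres t x).gradient

/-- Time derivative of the velocity at fixed `x` (uses the stretching law `ω′ = dω`). [folklore] -/
theorem hasDerivAt_vel {t : ℝ} (ht : t < 1) (x : E3) :
    HasDerivAt (fun s => vel s x) (strDeriv t • D0 x + (amp t * str t / 2) • J x) t := by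
  have h1 := (hasDerivAt_str ht).smul_const (D0 x)
  have h2 := ((hasDerivAt_amp ht).div_const 2).smul_const (J x)
  exact h1.add h2

/-- The one-sided time derivative within `[0,1)` agrees with it. [folklore] -/
theorem timeDerivWithin_vel {t : ℝ} (ht : t ∈ Ico (0:ℝ) 1) (x : E3) :
    timeDerivWithin (Ico 0 1) vel t x = strDeriv t • D0 x + (amp t * str t / 2) • J x := by
  rw [timeDerivWithin_apply]
  exact ((hasDerivAt_vel ht.2 x).hasDerivWithinAt).derivWithin (uniqueDiffOn_Ico 0 1 t ht)

/-- **The momentum equation** `∂ₜu + (u·∇)u = νΔu − ∇p` holds pointwise on `[0,1) × ℝ³` (any `ν`: `Δu = 0`). [folklore] -/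
theorem momentum_vel (ν : ℝ) {t : ℝ} (ht : t ∈ Ico (0:ℝ) 1) (x : E3) :
    timeDerivWithin (Ico 0 1) vel t x + convect (vel t) (vel t) x =
      ν • (Δ (vel t)) x - gradient (pres t) x + (0 : ℝ → E3 → E3) t x := by
  rw [timeDerivWithin_vel ht, show vel t = linVel (str t) (amp t) from rfl, convect_linVel,
    laplacian_linVel, gradient_pres]
  ext i
  fin_cases i <;> simp [presGrad, P1, P2] <;> ring

/-- Joint smoothness of `(t, x) ↦ u(t, x)` below `t = 1`. [folklore] -/
theorem contDiffAt_uncurry_vel {t : ℝ} (ht : t < 1) (x : E3) {n : WithTop ℕ∞} :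
    ContDiffAt ℝ n (Function.uncurry vel) (t, x) := by
  have hs : ContDiffAt ℝ n (fun p : ℝ × E3 => str p.1) (t, x) :=
    (contDiffAt_str ht).comp (t, x) contDiffAt_fst
  have ha : ContDiffAt ℝ n (fun p : ℝ × E3 => amp p.1 / 2) (t, x) :=
    ((contDiffAt_amp ht).comp (t, x) contDiffAt_fst).div_const 2
  have hD : ContDiffAt ℝ n (fun p : ℝ × E3 => D0 p.2) (t, x) :=
    D0.contDiff.contDiffAt.comp (t, x) contDiffAt_snd
  have hJ : ContDiffAt ℝ n (fun p : ℝ × E3 => J p.2) (t, x) :=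
    J.contDiff.contDiffAt.comp (t, x) contDiffAt_snd
  have := (hs.smul hD).add (ha.smul hJ)
  exact this

/-- `u` is jointly smooth on `[0,1) × ℝ³`. [folklore] -/
theorem isSmoothSpaceTimeOn_vel : IsSmoothSpaceTimeOn (Ico 0 1) vel := fun p hp =>
  (contDiffAt_uncurry_vel (mem_prod.1 hp).1.2 p.2).contDiffWithinAt

/-- Joint smoothness of `(t, x) ↦ p(t, x)` below `t = 1`. [folklore] -/
theorem contDiffAt_uncurry_pres {t : ℝ} (ht : t < 1) (x : E3) {n : WithTop ℕ∞} :
    ContDiffAt ℝ n (Function.uncurry pres) (t, x) := by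
  have hc : ∀ i : Fin 3, ContDiffAt ℝ n (fun p : ℝ × E3 => (p.2 i) ^ 2) (t, x) := fun i =>
    (((EuclideanSpace.proj (𝕜 := ℝ) i).contDiff.contDiffAt.comp (t, x) contDiffAt_snd)).pow 2
  have h1 : ContDiffAt ℝ n (fun p : ℝ × E3 => P1 p.1) (t, x) :=
    ((contDiffAt_strDeriv ht).add ((contDiffAt_str ht).pow 2)).comp (t, x) contDiffAt_fst
  have h2 : ContDiffAt ℝ n (fun p : ℝ × E3 => P2 p.1) (t, x) := by
    have : ContDiffAt ℝ n P2 t :=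
      (((contDiffAt_strDeriv ht).neg.div_const 2).add (((contDiffAt_str ht).pow 2).div_const 4)).sub
        (((contDiffAt_amp ht).pow 2).div_const 4)
    exact this.comp (t, x) contDiffAt_fst
  exact contDiffAt_const.mul ((h1.mul (hc 0)).add (h2.mul ((hc 1).add (hc 2))))

/-- `p` is jointly smooth on `[0,1) × ℝ³`. [folklore] -/
theorem isSmoothSpaceTimeOn_pres : IsSmoothSpaceTimeOn (Ico 0 1) pres := fun p hp =>
  (contDiffAt_uncurry_pres (mem_prod.1 hp).1.2 p.2).contDiffWithinAt

/-- **The linear flow is an exact classical Navier–Stokes solution on `[0,1) × ℝ³`** (any `ν`). [folklore] -/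
theorem isClassicalNSSolutionOn_vel (ν : ℝ) : IsClassicalNSSolutionOn (Ico 0 1) ν 0 vel pres where
  smooth_velocity := isSmoothSpaceTimeOn_vel
  smooth_pressure := isSmoothSpaceTimeOn_pres
  momentum _ ht x := momentum_vel ν ht x
  divFree _ _ x := divergence_linVel _ _ x



end Summit.NavierStokesRegularity.NavierStokesRegularity.Theorems.AdaptedFrequencyConverges.Negative

end
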